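import Literature.AlgebraicGeometry.Frobenioids.Dissection
import Literature.AnabelianGeometry.EtaleTheta.TemperedFrobenioidModel

/-!
# [EtTh] §3: claims carried by Remarks — Remark 3.7.1 (dissectibility types of a tempered Frobenioid)

Mochizuki, *The étale theta function …*, Publ. RIMS **45** (2009), §3, Remark 3.7.1, PRIMS PDF p. 80
(printed 306) [cite: MochizukiEtTh2009, Rmk 3.7.1 p.80]: "We recall [cf. [FrdII], §0] in passing that
if `D` is of weakly indissectible (respectively, strongly dissectible; weakly dissectible) type, then so
is `C`." Outcome of the W2-L2-10 remark audit (seat abc-iut-L6-t12): this Remark carries a CLAIM — the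
[EtTh] instance of the [FrdII] §0 observation (author's text p. 5) that a Frobenioid over a base of one
of these three types is itself of that type, an observation that `Frobenioids/Dissection.lean`
deliberately leaves to the Frobenioid files — and is typed here as ONE named `Prop` over the REAL
category `TemperedFrobenioid.category` of a tempered Frobenioid (`TemperedFrobenioidModel.lean`, seat
abc-iut-L2-t3) and the tree's dissectibility types (`Frobenioids.IsOfWeaklyIndissectibleType`, …,
[FrdII] §0). Nothing is asserted; no side is taken. When the general [FrdII] §0 observation lands under
`Frobenioids/`, this fact is its specialisation.
-/

namespace Literature.AnabelianGeometry.EtaleTheta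

open CategoryTheory Opposite Literature.AlgebraicGeometry.Frobenioids

universe u₀ v₀ u v w

namespace TemperedFrobenioid

variable {D₀ : Type u₀} [Category.{v₀} D₀] {V : FrdIMonoidStub.{w}}
  {T : RealifiedDivisorMonoids (D₀ := D₀) V} {D : Type u} [Category.{v} D]
  {VD : FrdICatStub.{u, v, w} D} (C₀ : TemperedFrobenioid T D VD)

/-- **Remark 3.7.1** (p. 80): "if `D` is of weakly indissectible (respectively, strongly dissectible;
weakly dissectible) type, then so is `C`" — for the Frobenioid `C = C₀.category` of the tempered
Frobenioid over the base category `D`, with the (in)dissectibility types of [FrdII] §0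
(`Frobenioids/Dissection.lean`). Named fact (the text "recalls" it from [FrdII] §0).
[cite: MochizukiEtTh2009, Rmk 3.7.1 p.80] -/
def Remark371 : Prop :=
  (IsOfWeaklyIndissectibleType D → IsOfWeaklyIndissectibleType C₀.category) ∧
  (IsOfStronglyDissectibleType D → IsOfStronglyDissectibleType C₀.category) ∧
  (IsOfWeaklyDissectibleType D → IsOfWeaklyDissectibleType C₀.category)

end TemperedFrobenioid

end Literature.AnabelianGeometry.EtaleTheta
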